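import Mathlib
import HarnessLib
import Literature.MathematicalPhysics.StatisticalMechanics.WeightIntegrationDominatedStepABKM

/-!
# [ABKM19] — a Hölder pair for the two-kernel comparison with per-block constant at most `2·A_𝒫(θ)`

The volume-uniform pair property of [ABKM19] Lemma 8.4 in the tree
(`tayNormLE_fluct_sub_fluct_conn_of_torusFRD`, `weakNormLE_opC_sub_unif_of_torusFRD`) is stated for ANY Hölder
data `(p, q_H, ρ'')` with `p.HolderConjugate q_H`, `0 ≤ ρ'' < θ̄`, `p(1+θ) ≤ 1+ρ''`, and pays the per-block
integration constant `A_𝒫(ρ'')^{1/p}` (`A_𝒫(ρ) = weightIntConstRho θ̄ ρ c₁` of Theorem 7.1 (w7)), which exceeds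
the package constant `A_𝒫(θ)` for every admissible choice but tends to it as `ρ'' ↓ θ`, `p ↓ 1`.  This file
picks, by continuity at `ρ'' = θ`, admissible Hölder data with

* **`exists_holderPair_weightIntConstRho_le_two_mul`** — `A_𝒫(ρ'')^{1/p} ≤ 2·A_𝒫(θ)`,

so that (with the polynomial factor of the connected-polymer lemma absorbed into `2^d`) the per-block constant of
the two-kernel comparison is at most `2^{d+1}·max(1, A_𝒫')`, inside the room the package condition `hc3A` leaves
(`AbkmPackageLargeSetMargin`).  Also `continuousAt_weightIntConstRho` (continuity of `ρ ↦ A_𝒫(ρ)` on `ρ > −1`).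
Everything is proved; no named fact.  Use (honest scope): side data for the child `TwoKernelSkBound` of the rung
route `Summits/HubbardSuperconductivity/…/Theses/ComplexGFFStiffness`; nothing about superconductivity in the Hubbard
model.

## References
* S. Adams, S. Buchholz, R. Kotecký, S. Müller, arXiv:1910.13564 — Theorem 7.1 (w7), Lemma 8.4, Lemma 12.6
  [AdamsBuchholzKoteckyMuller2019].
-/

noncomputable section

namespace Literature.MathematicalPhysics.StatisticalMechanics.GradientRG

open Filter Topology

/-- `ρ ↦ A_𝒫(ρ) = weightIntConstRho θ̄ ρ c₁` is continuous at every `ρ` with `1 + ρ > 0` and `ρ < θ̄` (`θ̄ > 0`).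
[cite: AdamsBuchholzKoteckyMuller2019, Theorem 7.1 (w7)] -/
theorem continuousAt_weightIntConstRho {θbar c₁ ρ : ℝ} (hθbar : 0 < θbar) (hρ1 : 0 < 1 + ρ) (hρ : ρ < θbar) :
    ContinuousAt (fun t : ℝ => weightIntConstRho θbar t c₁) ρ := by
  unfold weightIntConstRho
  have h1θ : 0 < 1 + θbar := by linarith
  have hbase : ContinuousAt (fun t : ℝ => 1 - (1 + t) / (1 + θbar)) ρ :=
    (continuous_const.sub ((continuous_const.add continuous_id).div_const _)).continuousAt
  have hden : ContinuousAt (fun t : ℝ => 2 * ((1 + t) / (1 + θbar))) ρ :=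
    (continuous_const.mul ((continuous_const.add continuous_id).div_const _)).continuousAt
  have hnum : ContinuousAt (fun t : ℝ => (1 + t) * c₁) ρ :=
    ((continuous_const.add continuous_id).mul continuous_const).continuousAt
  have hden0 : 2 * ((1 + ρ) / (1 + θbar)) ≠ 0 := by positivity
  have hexp : ContinuousAt (fun t : ℝ => -((1 + t) * c₁ / (2 * ((1 + t) / (1 + θbar))))) ρ :=
    (hnum.div hden hden0).neg
  have hb0 : 1 - (1 + ρ) / (1 + θbar) ≠ 0 := by
    have : (1 + ρ) / (1 + θbar) < 1 := by rw [div_lt_one h1θ]; linarith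
    linarith
  exact hbase.rpow hexp (Or.inl hb0)

/-- **Admissible Hölder data with per-block constant at most `2A_𝒫(θ)`**: for `0 ≤ θ < θ̄` and `c₁ ≥ 0` there
are `p, q_H, ρ''` with `p.HolderConjugate q_H`, `θ ≤ ρ'' < θ̄` (so `0 ≤ ρ''`), `p(1+θ) ≤ 1+ρ''` and
`A_𝒫(ρ'')^{1/p} ≤ 2·A_𝒫(θ)` (continuity of `ρ'' ↦ A_𝒫(ρ'')^{(1+θ)/(1+ρ'')}` at `θ`, where it equals `A_𝒫(θ) ≥ 1`).
[cite: AdamsBuchholzKoteckyMuller2019, Lemma 8.4 / Theorem 7.1 (w7)] -/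
theorem exists_holderPair_weightIntConstRho_le_two_mul {θbar θ c₁ : ℝ} (hθbar : 0 < θbar) (hθ0 : 0 ≤ θ)
    (hθ : θ < θbar) (hc₁ : 0 ≤ c₁) :
    ∃ p qH ρ'' : ℝ, p.HolderConjugate qH ∧ 0 ≤ ρ'' ∧ ρ'' < θbar ∧ θ ≤ ρ'' ∧ p * (1 + θ) ≤ 1 + ρ'' ∧
      weightIntConstRho θbar ρ'' c₁ ^ (1 / p) ≤ 2 * weightIntConstRho θbar θ c₁ := by
  set W : ℝ → ℝ := fun t => weightIntConstRho θbar t c₁ with hW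
  have h1θ : 0 < 1 + θ := by linarith
  have hWθ1 : 1 ≤ W θ := one_le_weightIntConstRho hθbar hθ0 hθ hc₁
  have hWθ0 : 0 < W θ := lt_of_lt_of_le one_pos hWθ1
  -- `g(t) = W(t)^{(1+θ)/(1+t)}` is continuous at `θ` with `g(θ) = W(θ)`
  set g : ℝ → ℝ := fun t => W t ^ ((1 + θ) / (1 + t)) with hg
  have hWc : ContinuousAt W θ := continuousAt_weightIntConstRho hθbar h1θ hθ
  have hec : ContinuousAt (fun t : ℝ => (1 + θ) / (1 + t)) θ :=
    continuousAt_const.div (continuousAt_const.add continuousAt_id) h1θ.ne'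
  have hgc : ContinuousAt g θ := hWc.rpow hec (Or.inl hWθ0.ne')
  have hgθ : g θ = W θ := by
    show W θ ^ ((1 + θ) / (1 + θ)) = W θ
    rw [div_self h1θ.ne', Real.rpow_one]
  obtain ⟨δ, hδ, hδg⟩ := Metric.continuousAt_iff.1 hgc (W θ) hWθ0
  -- the choice of `ρ''`
  set ρ'' : ℝ := θ + min (δ / 2) ((θbar - θ) / 2) with hρ''
  have hmin0 : 0 < min (δ / 2) ((θbar - θ) / 2) := lt_min (by linarith) (by linarith)
  have hρ''θ : θ < ρ'' := by rw [hρ'']; linarith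
  have hρ''bar : ρ'' < θbar := by
    have := min_le_right (δ / 2) ((θbar - θ) / 2)
    rw [hρ'']; linarith
  have hdist : dist ρ'' θ < δ := by
    rw [Real.dist_eq, hρ'', add_sub_cancel_left, abs_of_pos hmin0]
    linarith [min_le_left (δ / 2) ((θbar - θ) / 2)]
  have h1ρ'' : 0 < 1 + ρ'' := by linarith
  -- the Hölder pair
  set p : ℝ := (1 + ρ'') / (1 + θ) with hp
  have hp1 : 1 < p := by rw [hp, one_lt_div h1θ]; linarith
  refine ⟨p, Real.conjExponent p, ρ'', Real.HolderConjugate.conjExponent hp1, by linarith, hρ''bar, hρ''θ.le,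
    ?_, ?_⟩
  · rw [hp, div_mul_cancel₀ _ h1θ.ne']
  · have hinv : 1 / p = (1 + θ) / (1 + ρ'') := by rw [hp, one_div_div]
    have hlt := hδg hdist
    rw [hgθ, Real.dist_eq] at hlt
    have hle : g ρ'' < 2 * W θ := by
      have := (abs_lt.1 hlt).2
      linarith
    show W ρ'' ^ (1 / p) ≤ 2 * W θ
    rw [hinv]
    exact hle.le

/-- **Admissible Hölder data with per-block constant at most `(1+ε)·A_𝒫(θ)`** (any `ε > 0`): for `0 ≤ θ < θ̄`
and `c₁ ≥ 0` there are `p, q_H, ρ''` with `p.HolderConjugate q_H`, `θ ≤ ρ'' < θ̄`, `p(1+θ) ≤ 1+ρ''` and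
`A_𝒫(ρ'')^{1/p} ≤ (1+ε)·A_𝒫(θ)` (continuity of `ρ'' ↦ A_𝒫(ρ'')^{(1+θ)/(1+ρ'')}` at `θ`).  The version consumed by the
volume-uniform two-kernel comparison of `S_k`, where the admissible inflation `1 + ε` of the per-block constant is the
room `kappaABKM(r)/(1 + e^{1/4} + Δ) = 1 + Θ(r)` left by the package condition `hc3A` (line `banach_two_kernel`).
[cite: AdamsBuchholzKoteckyMuller2019, Lemma 8.4 / Theorem 7.1 (w7)] -/
theorem exists_holderPair_weightIntConstRho_le_one_add_mul {θbar θ c₁ ε : ℝ} (hθbar : 0 < θbar) (hθ0 : 0 ≤ θ)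
    (hθ : θ < θbar) (hc₁ : 0 ≤ c₁) (hε : 0 < ε) :
    ∃ p qH ρ'' : ℝ, p.HolderConjugate qH ∧ 0 ≤ ρ'' ∧ ρ'' < θbar ∧ θ ≤ ρ'' ∧ p * (1 + θ) ≤ 1 + ρ'' ∧
      weightIntConstRho θbar ρ'' c₁ ^ (1 / p) ≤ (1 + ε) * weightIntConstRho θbar θ c₁ := by
  set W : ℝ → ℝ := fun t => weightIntConstRho θbar t c₁ with hW
  have h1θ : 0 < 1 + θ := by linarith
  have hWθ1 : 1 ≤ W θ := one_le_weightIntConstRho hθbar hθ0 hθ hc₁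
  have hWθ0 : 0 < W θ := lt_of_lt_of_le one_pos hWθ1
  -- `g(t) = W(t)^{(1+θ)/(1+t)}` is continuous at `θ` with `g(θ) = W(θ)`
  set g : ℝ → ℝ := fun t => W t ^ ((1 + θ) / (1 + t)) with hg
  have hWc : ContinuousAt W θ := continuousAt_weightIntConstRho hθbar h1θ hθ
  have hec : ContinuousAt (fun t : ℝ => (1 + θ) / (1 + t)) θ :=
    continuousAt_const.div (continuousAt_const.add continuousAt_id) h1θ.ne'
  have hgc : ContinuousAt g θ := hWc.rpow hec (Or.inl hWθ0.ne')
  have hgθ : g θ = W θ := by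
    show W θ ^ ((1 + θ) / (1 + θ)) = W θ
    rw [div_self h1θ.ne', Real.rpow_one]
  have hεW : 0 < ε * W θ := mul_pos hε hWθ0
  obtain ⟨δ, hδ, hδg⟩ := Metric.continuousAt_iff.1 hgc (ε * W θ) hεW
  -- the choice of `ρ''`
  set ρ'' : ℝ := θ + min (δ / 2) ((θbar - θ) / 2) with hρ''
  have hmin0 : 0 < min (δ / 2) ((θbar - θ) / 2) := lt_min (by linarith) (by linarith)
  have hρ''θ : θ < ρ'' := by rw [hρ'']; linarith
  have hρ''bar : ρ'' < θbar := by
    have := min_le_right (δ / 2) ((θbar - θ) / 2)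
    rw [hρ'']; linarith
  have hdist : dist ρ'' θ < δ := by
    rw [Real.dist_eq, hρ'', add_sub_cancel_left, abs_of_pos hmin0]
    linarith [min_le_left (δ / 2) ((θbar - θ) / 2)]
  have h1ρ'' : 0 < 1 + ρ'' := by linarith
  -- the Hölder pair
  set p : ℝ := (1 + ρ'') / (1 + θ) with hp
  have hp1 : 1 < p := by rw [hp, one_lt_div h1θ]; linarith
  refine ⟨p, Real.conjExponent p, ρ'', Real.HolderConjugate.conjExponent hp1, by linarith, hρ''bar, hρ''θ.le,
    ?_, ?_⟩
  · rw [hp, div_mul_cancel₀ _ h1θ.ne']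
  · have hinv : 1 / p = (1 + θ) / (1 + ρ'') := by rw [hp, one_div_div]
    have hlt := hδg hdist
    rw [hgθ, Real.dist_eq] at hlt
    have hle : g ρ'' < (1 + ε) * W θ := by
      have := (abs_lt.1 hlt).2
      linarith
    show W ρ'' ^ (1 / p) ≤ (1 + ε) * W θ
    rw [hinv]
    exact hle.le

end Literature.MathematicalPhysics.StatisticalMechanics.GradientRG

end
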